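import Summits.AtomisticToContinuum.HydrodynamicLimit.Theses.ChapmanEnskogBBGKY

/-!
# Birth skeleton of the piece `VelocityDeviationEntropyBound` (strategist split 2/3 of `ContactBilinearEntropyBound`,
# stmt-AtomisticToContinuum-17607; parent stmt-AtomisticToContinuum-11892, route ChapmanEnskogBBGKY)

Three registered stubs: the OPEN INPUT `stub_sixthMomentBound` (an `L∞_x` bound on the sixth velocity moments of the
one-body marginal along the true flow, `N ≥ N₀`, `s ≤ t`; implied by the route's support `OneBodyGaussianBound`), the
technology step `stub_hellingerOfMoments` (given that input: Hellinger `(∫w|f−m|)² ≤ 2∫w²(f+m)·KL(f‖m)` per point, so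
`S^vel_N ≤ C·E_N + δ_N` with `E_N = ∫_(0,t) klDiv(F¹_N(s)·vol ‖ (ρ_F ⊗ M_(1,θ_s,u_s))·vol) ds`, `δ_N = ⊤` for `N < N₀`), and the
EXACT velocity chain rule `stub_velocityChainRule` (`E_N ≤ ∫klDiv(law_s‖localGibbs_s)/(N+1)`: conditionally on positions
the reference velocities are independent Maxwellians for ANY activity `a`; chain rule, superadditivity of KL w.r.t. a
product reference, convexity, exchangeability of the transported canonical law). Kernel-checked composition
`VelocityDeviationEntropyBound_of` (`σ₀ = min`, `linBound_of_le_div`). `sorry` only in `stub_*`.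
-/

noncomputable section

open MeasureTheory Filter Set Topology
open scoped ENNReal NNReal

namespace Summit.AtomisticToContinuum.HydrodynamicLimit.Cruxes.ContactBilinearEntropyBound.VelocityDeviationBirth

/-- Transitivity of asymptotic linear bounds in `ℝ≥0∞`: `X ≤ C₁Y + δ₁`, `Y ≤ C₂Z + δ₂`, `δᵢ → 0` give
`X ≤ C₁C₂·Z + (C₁δ₂ + δ₁)` with `C₁δ₂ + δ₁ → 0` (`C₁ < ∞`). [folklore] -/
theorem linBound_trans {X Y Z : ℕ → ℝ≥0∞}
    (h₁ : ∃ C : ℝ≥0, ∃ δ : ℕ → ℝ≥0∞, Tendsto δ atTop (𝓝 0) ∧ ∀ N : ℕ, X N ≤ (C : ℝ≥0∞) * Y N + δ N)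
    (h₂ : ∃ C : ℝ≥0, ∃ δ : ℕ → ℝ≥0∞, Tendsto δ atTop (𝓝 0) ∧ ∀ N : ℕ, Y N ≤ (C : ℝ≥0∞) * Z N + δ N) :
    ∃ C : ℝ≥0, ∃ δ : ℕ → ℝ≥0∞, Tendsto δ atTop (𝓝 0) ∧ ∀ N : ℕ, X N ≤ (C : ℝ≥0∞) * Z N + δ N := by
  obtain ⟨C₁, δ₁, hδ₁, h₁⟩ := h₁
  obtain ⟨C₂, δ₂, hδ₂, h₂⟩ := h₂
  refine ⟨C₁ * C₂, fun N => (C₁ : ℝ≥0∞) * δ₂ N + δ₁ N, ?_, fun N => ?_⟩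
  · have hmul : Tendsto (fun N => (C₁ : ℝ≥0∞) * δ₂ N) atTop (𝓝 0) := by
      simpa using ENNReal.Tendsto.const_mul hδ₂ (Or.inr ENNReal.coe_ne_top)
    simpa using hmul.add hδ₁
  · calc X N ≤ (C₁ : ℝ≥0∞) * Y N + δ₁ N := h₁ N
      _ ≤ (C₁ : ℝ≥0∞) * ((C₂ : ℝ≥0∞) * Z N + δ₂ N) + δ₁ N := by gcongr; exact h₂ N
      _ = ((C₁ * C₂ : ℝ≥0) : ℝ≥0∞) * Z N + ((C₁ : ℝ≥0∞) * δ₂ N + δ₁ N) := by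
          simp only [ENNReal.coe_mul]; ring

/-- An asymptotic linear bound followed by an exact pointwise domination `Y ≤ K/(N+1)`. [folklore] -/
theorem linBound_of_le_div {X Y K : ℕ → ℝ≥0∞}
    (h₁ : ∃ C : ℝ≥0, ∃ δ : ℕ → ℝ≥0∞, Tendsto δ atTop (𝓝 0) ∧ ∀ N : ℕ, X N ≤ (C : ℝ≥0∞) * Y N + δ N)
    (h₂ : ∀ N : ℕ, Y N ≤ K N / ((N : ℝ≥0∞) + 1)) :
    ∃ C : ℝ≥0, ∃ δ : ℕ → ℝ≥0∞, Tendsto δ atTop (𝓝 0) ∧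
      ∀ N : ℕ, X N ≤ (C : ℝ≥0∞) * K N / ((N : ℝ≥0∞) + 1) + δ N := by
  obtain ⟨C, δ, hδ, h⟩ := h₁
  refine ⟨C, δ, hδ, fun N => ?_⟩
  calc X N ≤ (C : ℝ≥0∞) * Y N + δ N := h N
    _ ≤ (C : ℝ≥0∞) * (K N / ((N : ℝ≥0∞) + 1)) + δ N := by gcongr; exact h₂ N
    _ = (C : ℝ≥0∞) * K N / ((N : ℝ≥0∞) + 1) + δ N := by rw [mul_div_assoc]

/-- Composition of asymptotic linear bounds through two interpolating functionals:
`Q ≤ C₁(S^v + S^d) + δ₁`, `S^v ≤ C₂K/(N+1) + δ₂`, `S^d ≤ C₃K/(N+1) + δ₃` give `Q ≤ C₁(C₂+C₃)K/(N+1) + o(1)`.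
[folklore] -/
theorem asymptoticBound_chain {Q Sv Sd K : ℕ → ℝ≥0∞}
    (hR : ∃ C : ℝ≥0, ∃ δ : ℕ → ℝ≥0∞, Tendsto δ atTop (𝓝 0) ∧
      ∀ N : ℕ, Q N ≤ (C : ℝ≥0∞) * (Sv N + Sd N) + δ N)
    (hV : ∃ C : ℝ≥0, ∃ δ : ℕ → ℝ≥0∞, Tendsto δ atTop (𝓝 0) ∧
      ∀ N : ℕ, Sv N ≤ (C : ℝ≥0∞) * K N / ((N : ℝ≥0∞) + 1) + δ N)
    (hD : ∃ C : ℝ≥0, ∃ δ : ℕ → ℝ≥0∞, Tendsto δ atTop (𝓝 0) ∧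
      ∀ N : ℕ, Sd N ≤ (C : ℝ≥0∞) * K N / ((N : ℝ≥0∞) + 1) + δ N) :
    ∃ C : ℝ≥0, ∃ δ : ℕ → ℝ≥0∞, Tendsto δ atTop (𝓝 0) ∧
      ∀ N : ℕ, Q N ≤ (C : ℝ≥0∞) * K N / ((N : ℝ≥0∞) + 1) + δ N := by
  obtain ⟨C₁, δ₁, hδ₁, h₁⟩ := hR
  obtain ⟨C₂, δ₂, hδ₂, h₂⟩ := hV
  obtain ⟨C₃, δ₃, hδ₃, h₃⟩ := hD
  refine ⟨C₁ * (C₂ + C₃), fun N => (C₁ : ℝ≥0∞) * (δ₂ N + δ₃ N) + δ₁ N, ?_, fun N => ?_⟩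
  · have h23 : Tendsto (fun N => δ₂ N + δ₃ N) atTop (𝓝 0) := by simpa using hδ₂.add hδ₃
    have hmul : Tendsto (fun N => (C₁ : ℝ≥0∞) * (δ₂ N + δ₃ N)) atTop (𝓝 0) := by
      simpa using ENNReal.Tendsto.const_mul h23 (Or.inr ENNReal.coe_ne_top)
    simpa using hmul.add hδ₁
  · calc Q N ≤ (C₁ : ℝ≥0∞) * (Sv N + Sd N) + δ₁ N := h₁ N
      _ ≤ (C₁ : ℝ≥0∞) * (((C₂ : ℝ≥0∞) * K N / ((N : ℝ≥0∞) + 1) + δ₂ N) +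
            ((C₃ : ℝ≥0∞) * K N / ((N : ℝ≥0∞) + 1) + δ₃ N)) + δ₁ N := by
          gcongr
          · exact h₂ N
          · exact h₃ N
      _ = ((C₁ * (C₂ + C₃) : ℝ≥0) : ℝ≥0∞) * K N / ((N : ℝ≥0∞) + 1) +
            ((C₁ : ℝ≥0∞) * (δ₂ N + δ₃ N) + δ₁ N) := by
          simp only [ENNReal.coe_mul, ENNReal.coe_add, div_eq_mul_inv]; ring

/-- Local copy of the piece `VelocityDeviationEntropyBound` (the route decl once the split is rendered). [folklore] -/
def VelocityDeviationEntropyBound : Prop :=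
  ∀ (a₀ θ₀ : Literature.MathematicalPhysics.KineticTheory.T3 → ℝ) (u₀ : Literature.MathematicalPhysics.KineticTheory.T3 → Literature.MathematicalPhysics.KineticTheory.V3), Continuous a₀ → Continuous θ₀ → Continuous u₀ → (∀ x, 0 < a₀ x) → (∀ x, 0 < θ₀ x) → ∃ σ₀ : ℝ, 0 < σ₀ ∧ ∀ σ : ℝ, 0 < σ → σ < σ₀ → ∀ (T : ℝ) (ρ θ : ℝ → Literature.MathematicalPhysics.KineticTheory.T3 → ℝ) (u : ℝ → Literature.MathematicalPhysics.KineticTheory.T3 → Literature.MathematicalPhysics.KineticTheory.V3), Literature.MathematicalPhysics.KineticTheory.IsHardSphereEulerSolution σ T ρ u θ → ∀ Φ : (N : ℕ) → Literature.Analysis.FluidPDE.HardSphereFlow (Literature.Analysis.FluidPDE.Torus.geometry (Fin 3)) (Literature.MathematicalPhysics.KineticTheory.hsDiameter σ N) (N + 1), (∀ N, Measurable (fun p : ℝ × Literature.Analysis.FluidPDE.Config (N + 1) (Fin 3) Literature.MathematicalPhysics.KineticTheory.T3 => (Φ N).flow p.1 p.2)) → Literature.MathematicalPhysics.KineticTheory.TendstoHydroFieldsAt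 (fun N => Literature.MathematicalPhysics.KineticTheory.localGibbsLaw σ a₀ u₀ θ₀ N (Φ N)) Φ ρ u θ 0 → ∀ t ∈ Set.Ico 0 T, ∀ a : ℝ → Literature.MathematicalPhysics.KineticTheory.T3 → ℝ, Continuous (fun p : ℝ × Literature.MathematicalPhysics.KineticTheory.T3 => a p.1 p.2) → (∀ s x, 0 < a s x) → let G : Literature.Analysis.FluidPDE.Geometry (Fin 3) Literature.MathematicalPhysics.KineticTheory.T3 := Literature.Analysis.FluidPDE.Torus.geometry (Fin 3); let ε : ℕ → ℝ := fun N => Literature.MathematicalPhysics.KineticTheory.hsDiameter σ N; let P : (N : ℕ) → MeasureTheory.Measure (Literature.Analysis.FluidPDE.Config (N + 1) (Fin 3) Literature.MathematicalPhysics.KineticTheory.T3) := fun N => Literature.MathematicalPhysics.KineticTheory.localGibbsLaw σ a₀ u₀ θ₀ N (Φ N); let W : (N : ℕ) → ℝ → Literature.Analysis.FluidPDE.Config (N + 1) (Fin 3) Literature.MathematicalPhysics.KineticTheory.T3 → ℝ := fun N s => (Literature.Analysis.FluidPDE.hardSphereDomain G (N + 1) (ε N)).indicator (Literature.Analysis.FluidPDE.hsTransport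 (Φ N) s (Literature.Analysis.FluidPDE.canonicalDensity G (ε N) (N + 1) (Literature.MathematicalPhysics.KineticTheory.localGibbsProfile a₀ u₀ θ₀))); let F1 : ℕ → ℝ → Literature.MathematicalPhysics.KineticTheory.T3 × Literature.MathematicalPhysics.KineticTheory.V3 → ℝ := fun N s y => Literature.Analysis.FluidPDE.nthMarginal (N + 1) 1 (W N s) (fun _ => y); let w : Literature.MathematicalPhysics.KineticTheory.V3 → ℝ := fun v => (1 + ‖v‖ ^ 2) * (1 + ‖v‖); let ρF : ℕ → ℝ → Literature.MathematicalPhysics.KineticTheory.T3 → ℝ := fun N s x => ∫ v, F1 N s (x, v); let Svel : ℕ → ENNReal := fun N => ∫⁻ s in Set.Ioo 0 t, ∫⁻ x : Literature.MathematicalPhysics.KineticTheory.T3, (∫⁻ v : Literature.MathematicalPhysics.KineticTheory.V3, ENNReal.ofReal (w v * |F1 N s (x, v) - ρF N s x * Literature.Analysis.FluidPDE.localMaxwellian 1 (θ s x) (u s x) v|)) ^ 2; ∃ C : NNReal, ∃ δ : ℕ → ENNReal, Filter.Tendsto δ Filter.atTop (nhds 0) ∧ ∀ N : ℕ, Svel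 N ≤ (C : ENNReal) * (∫⁻ s in Set.Ioo 0 t, InformationTheory.klDiv ((Φ N).lawAt (P N) s) (Literature.MathematicalPhysics.KineticTheory.localGibbsLaw σ (a s) (u s) (θ s) N (Φ N))) / ((N : ENNReal) + 1) + δ N

/-- Stub 1 (OPEN INPUT): uniform `L∞_x` bound on the sixth velocity moments of the one-body marginal along the hard-sphere evolution of local Gibbs data: `∃ K N₀, ∀ N ≥ N₀, ∀ s ∈ [0,t], a.e. x, ∫⁻ w(v)² F¹_N(s,x,v) dv ≤ K`, `w(v) = (1+|v|²)(1+|v|)` (implied by `OneBodyGaussianBound`; no conservation law gives it). [cite: GST2013, §6.1] -/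
theorem stub_sixthMomentBound :
  ∀ (a₀ θ₀ : Literature.MathematicalPhysics.KineticTheory.T3 → ℝ) (u₀ : Literature.MathematicalPhysics.KineticTheory.T3 → Literature.MathematicalPhysics.KineticTheory.V3), Continuous a₀ → Continuous θ₀ → Continuous u₀ → (∀ x, 0 < a₀ x) → (∀ x, 0 < θ₀ x) → ∃ σ₀ : ℝ, 0 < σ₀ ∧ ∀ σ : ℝ, 0 < σ → σ < σ₀ → ∀ (T : ℝ) (ρ θ : ℝ → Literature.MathematicalPhysics.KineticTheory.T3 → ℝ) (u : ℝ → Literature.MathematicalPhysics.KineticTheory.T3 → Literature.MathematicalPhysics.KineticTheory.V3), Literature.MathematicalPhysics.KineticTheory.IsHardSphereEulerSolution σ T ρ u θ → ∀ Φ : (N : ℕ) → Literature.Analysis.FluidPDE.HardSphereFlow (Literature.Analysis.FluidPDE.Torus.geometry (Fin 3)) (Literature.MathematicalPhysics.KineticTheory.hsDiameter σ N) (N + 1), (∀ N, Measurable (fun p : ℝ × Literature.Analysis.FluidPDE.Config (N + 1) (Fin 3) Literature.MathematicalPhysics.KineticTheory.T3 => (Φ N).flow p.1 p.2)) → Literature.MathematicalPhysics.KineticTheory.TendstoHydroFieldsAt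 (fun N => Literature.MathematicalPhysics.KineticTheory.localGibbsLaw σ a₀ u₀ θ₀ N (Φ N)) Φ ρ u θ 0 → ∀ t ∈ Set.Ico 0 T, let G : Literature.Analysis.FluidPDE.Geometry (Fin 3) Literature.MathematicalPhysics.KineticTheory.T3 := Literature.Analysis.FluidPDE.Torus.geometry (Fin 3); let ε : ℕ → ℝ := fun N => Literature.MathematicalPhysics.KineticTheory.hsDiameter σ N; let W : (N : ℕ) → ℝ → Literature.Analysis.FluidPDE.Config (N + 1) (Fin 3) Literature.MathematicalPhysics.KineticTheory.T3 → ℝ := fun N s => (Literature.Analysis.FluidPDE.hardSphereDomain G (N + 1) (ε N)).indicator (Literature.Analysis.FluidPDE.hsTransport (Φ N) s (Literature.Analysis.FluidPDE.canonicalDensity G (ε N) (N + 1) (Literature.MathematicalPhysics.KineticTheory.localGibbsProfile a₀ u₀ θ₀))); let F1 : ℕ → ℝ → Literature.MathematicalPhysics.KineticTheory.T3 × Literature.MathematicalPhysics.KineticTheory.V3 → ℝ := fun N s y => Literature.Analysis.FluidPDE.nthMarginal (N + 1) 1 (W N s) (fun _ => y); let w : Literature.MathematicalPhysics.KineticTheory.V3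 → ℝ := fun v => (1 + ‖v‖ ^ 2) * (1 + ‖v‖); ∃ K : NNReal, ∃ N₀ : ℕ, ∀ N : ℕ, N₀ ≤ N → ∀ s ∈ Set.Icc 0 t, ∀ᵐ x : Literature.MathematicalPhysics.KineticTheory.T3, ∫⁻ v : Literature.MathematicalPhysics.KineticTheory.V3, ENNReal.ofReal (w v ^ 2 * F1 N s (x, v)) ≤ (K : ENNReal) := by
  sorry

/-- Stub 2 (L, technology; every `σ > 0`): GIVEN the sixth-moment bound, the per-point Hellinger inequality `(∫w|F−ρ_F m| dv)² ≤ 2[∫w²(F+ρ_F m)dv]·ρ_F·KL(f_x‖m_x)` and `∫_x ρ_F KL(f_x‖m_x) = klDiv(F¹·vol ‖ (ρ_F⊗m)·vol)` give `S^vel_N ≤ C·E_N + δ_N` (`δ_N = ⊤` for `N < N₀`, Gaussian moments of `m` bounded on `[0,t]×𝕋³`). [cite: Villani2002, Ch. 2] [cite: Csiszar1975, §1] -/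
theorem stub_hellingerOfMoments :
  ∀ (a₀ θ₀ : Literature.MathematicalPhysics.KineticTheory.T3 → ℝ) (u₀ : Literature.MathematicalPhysics.KineticTheory.T3 → Literature.MathematicalPhysics.KineticTheory.V3), Continuous a₀ → Continuous θ₀ → Continuous u₀ → (∀ x, 0 < a₀ x) → (∀ x, 0 < θ₀ x) → ∀ σ : ℝ, 0 < σ → ∀ (T : ℝ) (ρ θ : ℝ → Literature.MathematicalPhysics.KineticTheory.T3 → ℝ) (u : ℝ → Literature.MathematicalPhysics.KineticTheory.T3 → Literature.MathematicalPhysics.KineticTheory.V3), Literature.MathematicalPhysics.KineticTheory.IsHardSphereEulerSolution σ T ρ u θ → ∀ Φ : (N : ℕ) → Literature.Analysis.FluidPDE.HardSphereFlow (Literature.Analysis.FluidPDE.Torus.geometry (Fin 3)) (Literature.MathematicalPhysics.KineticTheory.hsDiameter σ N) (N + 1), (∀ N, Measurable (fun p : ℝ × Literature.Analysis.FluidPDE.Config (N + 1) (Fin 3) Literature.MathematicalPhysics.KineticTheory.T3 => (Φ N).flow p.1 p.2)) → ∀ t ∈ Set.Ico 0 T, let G : Literature.Analysis.FluidPDE.Geometry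 (Fin 3) Literature.MathematicalPhysics.KineticTheory.T3 := Literature.Analysis.FluidPDE.Torus.geometry (Fin 3); let ε : ℕ → ℝ := fun N => Literature.MathematicalPhysics.KineticTheory.hsDiameter σ N; let W : (N : ℕ) → ℝ → Literature.Analysis.FluidPDE.Config (N + 1) (Fin 3) Literature.MathematicalPhysics.KineticTheory.T3 → ℝ := fun N s => (Literature.Analysis.FluidPDE.hardSphereDomain G (N + 1) (ε N)).indicator (Literature.Analysis.FluidPDE.hsTransport (Φ N) s (Literature.Analysis.FluidPDE.canonicalDensity G (ε N) (N + 1) (Literature.MathematicalPhysics.KineticTheory.localGibbsProfile a₀ u₀ θ₀))); let F1 : ℕ → ℝ → Literature.MathematicalPhysics.KineticTheory.T3 × Literature.MathematicalPhysics.KineticTheory.V3 → ℝ := fun N s y => Literature.Analysis.FluidPDE.nthMarginal (N + 1) 1 (W N s) (fun _ => y); let w : Literature.MathematicalPhysics.KineticTheory.V3 → ℝ := fun v => (1 + ‖v‖ ^ 2) * (1 + ‖v‖); let ρF : ℕ → ℝ → Literature.MathematicalPhysics.KineticTheory.T3 → ℝ := fun N s x => ∫ v, F1 N s (x, v); let Svel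 : ℕ → ENNReal := fun N => ∫⁻ s in Set.Ioo 0 t, ∫⁻ x : Literature.MathematicalPhysics.KineticTheory.T3, (∫⁻ v : Literature.MathematicalPhysics.KineticTheory.V3, ENNReal.ofReal (w v * |F1 N s (x, v) - ρF N s x * Literature.Analysis.FluidPDE.localMaxwellian 1 (θ s x) (u s x) v|)) ^ 2; let μF : ℕ → ℝ → MeasureTheory.Measure (Literature.MathematicalPhysics.KineticTheory.T3 × Literature.MathematicalPhysics.KineticTheory.V3) := fun N s => (MeasureTheory.volume : MeasureTheory.Measure (Literature.MathematicalPhysics.KineticTheory.T3 × Literature.MathematicalPhysics.KineticTheory.V3)).withDensity (fun y => ENNReal.ofReal (F1 N s y)); let μM : ℕ → ℝ → MeasureTheory.Measure (Literature.MathematicalPhysics.KineticTheory.T3 × Literature.MathematicalPhysics.KineticTheory.V3) := fun N s => (MeasureTheory.volume : MeasureTheory.Measure (Literature.MathematicalPhysics.KineticTheory.T3 × Literature.MathematicalPhysics.KineticTheory.V3)).withDensity (fun y => ENNReal.ofReal (ρF N s y.1 * Literature.Analysis.FluidPDE.localMaxwellian 1 (θ s y.1) (u s y.1) y.2)); let E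 : ℕ → ENNReal := fun N => ∫⁻ s in Set.Ioo 0 t, InformationTheory.klDiv (μF N s) (μM N s); (∃ K : NNReal, ∃ N₀ : ℕ, ∀ N : ℕ, N₀ ≤ N → ∀ s ∈ Set.Icc 0 t, ∀ᵐ x : Literature.MathematicalPhysics.KineticTheory.T3, ∫⁻ v : Literature.MathematicalPhysics.KineticTheory.V3, ENNReal.ofReal (w v ^ 2 * F1 N s (x, v)) ≤ (K : ENNReal)) → ∃ C : NNReal, ∃ δ : ℕ → ENNReal, Filter.Tendsto δ Filter.atTop (nhds 0) ∧ ∀ N : ℕ, Svel N ≤ (C : ENNReal) * E N + δ N := by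
  sorry

/-- Stub 3 (L/XL, exact): for every activity profile `a`, `klDiv(F¹_N(s)·vol ‖ (ρ_F⊗M_(1,θ_s,u_s))·vol) ≤ klDiv(law_s ‖ localGibbsLaw σ (a s) (u s) (θ s))/(N+1)` pointwise in `s`, hence integrated over `(0,t)`: chain rule (velocities of the reference are independent Maxwellians conditionally on positions), superadditivity of KL w.r.t. a product reference, convexity in the first argument, exchangeability of the transported canonical law (`F1` = marginal of particle 0) and `lawAt = map (flow s)` with density `W N s`. [cite: KipnisLandim1999, App. 1 §8] [cite: Yau1991, §2] -/
theorem stub_velocityChainRule :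
  ∀ (a₀ θ₀ : Literature.MathematicalPhysics.KineticTheory.T3 → ℝ) (u₀ : Literature.MathematicalPhysics.KineticTheory.T3 → Literature.MathematicalPhysics.KineticTheory.V3), Continuous a₀ → Continuous θ₀ → Continuous u₀ → (∀ x, 0 < a₀ x) → (∀ x, 0 < θ₀ x) → ∃ σ₀ : ℝ, 0 < σ₀ ∧ ∀ σ : ℝ, 0 < σ → σ < σ₀ → ∀ (T : ℝ) (ρ θ : ℝ → Literature.MathematicalPhysics.KineticTheory.T3 → ℝ) (u : ℝ → Literature.MathematicalPhysics.KineticTheory.T3 → Literature.MathematicalPhysics.KineticTheory.V3), Literature.MathematicalPhysics.KineticTheory.IsHardSphereEulerSolution σ T ρ u θ → ∀ Φ : (N : ℕ) → Literature.Analysis.FluidPDE.HardSphereFlow (Literature.Analysis.FluidPDE.Torus.geometry (Fin 3)) (Literature.MathematicalPhysics.KineticTheory.hsDiameter σ N) (N + 1), (∀ N, Measurable (fun p : ℝ × Literature.Analysis.FluidPDE.Config (N + 1) (Fin 3) Literature.MathematicalPhysics.KineticTheory.T3 => (Φ N).flow p.1 p.2)) → Literature.MathematicalPhysics.KineticTheory.TendstoHydroFieldsAt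 (fun N => Literature.MathematicalPhysics.KineticTheory.localGibbsLaw σ a₀ u₀ θ₀ N (Φ N)) Φ ρ u θ 0 → ∀ t ∈ Set.Ico 0 T, ∀ a : ℝ → Literature.MathematicalPhysics.KineticTheory.T3 → ℝ, Continuous (fun p : ℝ × Literature.MathematicalPhysics.KineticTheory.T3 => a p.1 p.2) → (∀ s x, 0 < a s x) → let G : Literature.Analysis.FluidPDE.Geometry (Fin 3) Literature.MathematicalPhysics.KineticTheory.T3 := Literature.Analysis.FluidPDE.Torus.geometry (Fin 3); let ε : ℕ → ℝ := fun N => Literature.MathematicalPhysics.KineticTheory.hsDiameter σ N; let P : (N : ℕ) → MeasureTheory.Measure (Literature.Analysis.FluidPDE.Config (N + 1) (Fin 3) Literature.MathematicalPhysics.KineticTheory.T3) := fun N => Literature.MathematicalPhysics.KineticTheory.localGibbsLaw σ a₀ u₀ θ₀ N (Φ N); let W : (N : ℕ) → ℝ → Literature.Analysis.FluidPDE.Config (N + 1) (Fin 3) Literature.MathematicalPhysics.KineticTheory.T3 → ℝ := fun N s => (Literature.Analysis.FluidPDE.hardSphereDomain G (N + 1) (ε N)).indicator (Literature.Analysis.FluidPDE.hsTransport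 (Φ N) s (Literature.Analysis.FluidPDE.canonicalDensity G (ε N) (N + 1) (Literature.MathematicalPhysics.KineticTheory.localGibbsProfile a₀ u₀ θ₀))); let F1 : ℕ → ℝ → Literature.MathematicalPhysics.KineticTheory.T3 × Literature.MathematicalPhysics.KineticTheory.V3 → ℝ := fun N s y => Literature.Analysis.FluidPDE.nthMarginal (N + 1) 1 (W N s) (fun _ => y); let ρF : ℕ → ℝ → Literature.MathematicalPhysics.KineticTheory.T3 → ℝ := fun N s x => ∫ v, F1 N s (x, v); let μF : ℕ → ℝ → MeasureTheory.Measure (Literature.MathematicalPhysics.KineticTheory.T3 × Literature.MathematicalPhysics.KineticTheory.V3) := fun N s => (MeasureTheory.volume : MeasureTheory.Measure (Literature.MathematicalPhysics.KineticTheory.T3 × Literature.MathematicalPhysics.KineticTheory.V3)).withDensity (fun y => ENNReal.ofReal (F1 N s y)); let μM : ℕ → ℝ → MeasureTheory.Measure (Literature.MathematicalPhysics.KineticTheory.T3 × Literature.MathematicalPhysics.KineticTheory.V3) := fun N s => (MeasureTheory.volume : MeasureTheory.Measure (Literature.MathematicalPhysics.KineticTheory.T3 × Literature.MathematicalPhysics.KineticTheory.V3)).withDensity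 (fun y => ENNReal.ofReal (ρF N s y.1 * Literature.Analysis.FluidPDE.localMaxwellian 1 (θ s y.1) (u s y.1) y.2)); let E : ℕ → ENNReal := fun N => ∫⁻ s in Set.Ioo 0 t, InformationTheory.klDiv (μF N s) (μM N s); ∀ N : ℕ, E N ≤ (∫⁻ s in Set.Ioo 0 t, InformationTheory.klDiv ((Φ N).lawAt (P N) s) (Literature.MathematicalPhysics.KineticTheory.localGibbsLaw σ (a s) (u s) (θ s) N (Φ N))) / ((N : ENNReal) + 1) := by
  sorry

/-- **Composition**: `σ₀ := min σ₀^mom σ₀^chain`; at `σ < σ₀` the moment stub feeds the Hellinger stub (valid at every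
`σ > 0`), giving `S^vel ≤ C·E + δ`, and the exact chain rule turns `E` into the specific entropy integral
(`linBound_of_le_div`). Concludes the piece `VelocityDeviationEntropyBound` by name. [folklore] -/
theorem VelocityDeviationEntropyBound_of_stubs :
    (∀ (a₀ θ₀ : Literature.MathematicalPhysics.KineticTheory.T3 → ℝ) (u₀ : Literature.MathematicalPhysics.KineticTheory.T3 → Literature.MathematicalPhysics.KineticTheory.V3), Continuous a₀ → Continuous θ₀ → Continuous u₀ → (∀ x, 0 < a₀ x) → (∀ x, 0 < θ₀ x) → ∃ σ₀ : ℝ, 0 < σ₀ ∧ ∀ σ : ℝ, 0 < σ → σ < σ₀ → ∀ (T : ℝ) (ρ θ : ℝ → Literature.MathematicalPhysics.KineticTheory.T3 → ℝ) (u : ℝ → Literature.MathematicalPhysics.KineticTheory.T3 → Literature.MathematicalPhysics.KineticTheory.V3), Literature.MathematicalPhysics.KineticTheory.IsHardSphereEulerSolution σ T ρ u θ → ∀ Φ : (N : ℕ) → Literature.Analysis.FluidPDE.HardSphereFlow (Literature.Analysis.FluidPDE.Torus.geometry (Fin 3)) (Literature.MathematicalPhysics.KineticTheory.hsDiameter σ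 N) (N + 1), (∀ N, Measurable (fun p : ℝ × Literature.Analysis.FluidPDE.Config (N + 1) (Fin 3) Literature.MathematicalPhysics.KineticTheory.T3 => (Φ N).flow p.1 p.2)) → Literature.MathematicalPhysics.KineticTheory.TendstoHydroFieldsAt (fun N => Literature.MathematicalPhysics.KineticTheory.localGibbsLaw σ a₀ u₀ θ₀ N (Φ N)) Φ ρ u θ 0 → ∀ t ∈ Set.Ico 0 T, let G : Literature.Analysis.FluidPDE.Geometry (Fin 3) Literature.MathematicalPhysics.KineticTheory.T3 := Literature.Analysis.FluidPDE.Torus.geometry (Fin 3); let ε : ℕ → ℝ := fun N => Literature.MathematicalPhysics.KineticTheory.hsDiameter σ N; let W : (N : ℕ) → ℝ → Literature.Analysis.FluidPDE.Config (N + 1) (Fin 3) Literature.MathematicalPhysics.KineticTheory.T3 → ℝ := fun N s => (Literature.Analysis.FluidPDE.hardSphereDomain G (N + 1) (ε N)).indicator (Literature.Analysis.FluidPDE.hsTransport (Φ N) s (Literature.Analysis.FluidPDE.canonicalDensity G (ε N) (N + 1) (Literature.MathematicalPhysics.KineticTheory.localGibbsProfile a₀ u₀ θ₀))); let F1 : ℕ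 → ℝ → Literature.MathematicalPhysics.KineticTheory.T3 × Literature.MathematicalPhysics.KineticTheory.V3 → ℝ := fun N s y => Literature.Analysis.FluidPDE.nthMarginal (N + 1) 1 (W N s) (fun _ => y); let w : Literature.MathematicalPhysics.KineticTheory.V3 → ℝ := fun v => (1 + ‖v‖ ^ 2) * (1 + ‖v‖); ∃ K : NNReal, ∃ N₀ : ℕ, ∀ N : ℕ, N₀ ≤ N → ∀ s ∈ Set.Icc 0 t, ∀ᵐ x : Literature.MathematicalPhysics.KineticTheory.T3, ∫⁻ v : Literature.MathematicalPhysics.KineticTheory.V3, ENNReal.ofReal (w v ^ 2 * F1 N s (x, v)) ≤ (K : ENNReal)) →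
    (∀ (a₀ θ₀ : Literature.MathematicalPhysics.KineticTheory.T3 → ℝ) (u₀ : Literature.MathematicalPhysics.KineticTheory.T3 → Literature.MathematicalPhysics.KineticTheory.V3), Continuous a₀ → Continuous θ₀ → Continuous u₀ → (∀ x, 0 < a₀ x) → (∀ x, 0 < θ₀ x) → ∀ σ : ℝ, 0 < σ → ∀ (T : ℝ) (ρ θ : ℝ → Literature.MathematicalPhysics.KineticTheory.T3 → ℝ) (u : ℝ → Literature.MathematicalPhysics.KineticTheory.T3 → Literature.MathematicalPhysics.KineticTheory.V3), Literature.MathematicalPhysics.KineticTheory.IsHardSphereEulerSolution σ T ρ u θ → ∀ Φ : (N : ℕ) → Literature.Analysis.FluidPDE.HardSphereFlow (Literature.Analysis.FluidPDE.Torus.geometry (Fin 3)) (Literature.MathematicalPhysics.KineticTheory.hsDiameter σ N) (N + 1), (∀ N, Measurable (fun p : ℝ × Literature.Analysis.FluidPDE.Config (N + 1) (Fin 3) Literature.MathematicalPhysics.KineticTheory.T3 => (Φ N).flow p.1 p.2)) → ∀ t ∈ Set.Ico 0 T, let G : Literature.Analysis.FluidPDE.Geometry (Fin 3) Literature.MathematicalPhysics.KineticTheory.T3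 := Literature.Analysis.FluidPDE.Torus.geometry (Fin 3); let ε : ℕ → ℝ := fun N => Literature.MathematicalPhysics.KineticTheory.hsDiameter σ N; let W : (N : ℕ) → ℝ → Literature.Analysis.FluidPDE.Config (N + 1) (Fin 3) Literature.MathematicalPhysics.KineticTheory.T3 → ℝ := fun N s => (Literature.Analysis.FluidPDE.hardSphereDomain G (N + 1) (ε N)).indicator (Literature.Analysis.FluidPDE.hsTransport (Φ N) s (Literature.Analysis.FluidPDE.canonicalDensity G (ε N) (N + 1) (Literature.MathematicalPhysics.KineticTheory.localGibbsProfile a₀ u₀ θ₀))); let F1 : ℕ → ℝ → Literature.MathematicalPhysics.KineticTheory.T3 × Literature.MathematicalPhysics.KineticTheory.V3 → ℝ := fun N s y => Literature.Analysis.FluidPDE.nthMarginal (N + 1) 1 (W N s) (fun _ => y); let w : Literature.MathematicalPhysics.KineticTheory.V3 → ℝ := fun v => (1 + ‖v‖ ^ 2) * (1 + ‖v‖); let ρF : ℕ → ℝ → Literature.MathematicalPhysics.KineticTheory.T3 → ℝ := fun N s x => ∫ v, F1 N s (x, v); let Svel : ℕ → ENNReal := fun N => ∫⁻ s in Set.Ioo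 0 t, ∫⁻ x : Literature.MathematicalPhysics.KineticTheory.T3, (∫⁻ v : Literature.MathematicalPhysics.KineticTheory.V3, ENNReal.ofReal (w v * |F1 N s (x, v) - ρF N s x * Literature.Analysis.FluidPDE.localMaxwellian 1 (θ s x) (u s x) v|)) ^ 2; let μF : ℕ → ℝ → MeasureTheory.Measure (Literature.MathematicalPhysics.KineticTheory.T3 × Literature.MathematicalPhysics.KineticTheory.V3) := fun N s => (MeasureTheory.volume : MeasureTheory.Measure (Literature.MathematicalPhysics.KineticTheory.T3 × Literature.MathematicalPhysics.KineticTheory.V3)).withDensity (fun y => ENNReal.ofReal (F1 N s y)); let μM : ℕ → ℝ → MeasureTheory.Measure (Literature.MathematicalPhysics.KineticTheory.T3 × Literature.MathematicalPhysics.KineticTheory.V3) := fun N s => (MeasureTheory.volume : MeasureTheory.Measure (Literature.MathematicalPhysics.KineticTheory.T3 × Literature.MathematicalPhysics.KineticTheory.V3)).withDensity (fun y => ENNReal.ofReal (ρF N s y.1 * Literature.Analysis.FluidPDE.localMaxwellian 1 (θ s y.1) (u s y.1) y.2)); let E : ℕ → ENNReal := fun N => ∫⁻ s in Set.Ioo 0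 t, InformationTheory.klDiv (μF N s) (μM N s); (∃ K : NNReal, ∃ N₀ : ℕ, ∀ N : ℕ, N₀ ≤ N → ∀ s ∈ Set.Icc 0 t, ∀ᵐ x : Literature.MathematicalPhysics.KineticTheory.T3, ∫⁻ v : Literature.MathematicalPhysics.KineticTheory.V3, ENNReal.ofReal (w v ^ 2 * F1 N s (x, v)) ≤ (K : ENNReal)) → ∃ C : NNReal, ∃ δ : ℕ → ENNReal, Filter.Tendsto δ Filter.atTop (nhds 0) ∧ ∀ N : ℕ, Svel N ≤ (C : ENNReal) * E N + δ N) →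
    (∀ (a₀ θ₀ : Literature.MathematicalPhysics.KineticTheory.T3 → ℝ) (u₀ : Literature.MathematicalPhysics.KineticTheory.T3 → Literature.MathematicalPhysics.KineticTheory.V3), Continuous a₀ → Continuous θ₀ → Continuous u₀ → (∀ x, 0 < a₀ x) → (∀ x, 0 < θ₀ x) → ∃ σ₀ : ℝ, 0 < σ₀ ∧ ∀ σ : ℝ, 0 < σ → σ < σ₀ → ∀ (T : ℝ) (ρ θ : ℝ → Literature.MathematicalPhysics.KineticTheory.T3 → ℝ) (u : ℝ → Literature.MathematicalPhysics.KineticTheory.T3 → Literature.MathematicalPhysics.KineticTheory.V3), Literature.MathematicalPhysics.KineticTheory.IsHardSphereEulerSolution σ T ρ u θ → ∀ Φ : (N : ℕ) → Literature.Analysis.FluidPDE.HardSphereFlow (Literature.Analysis.FluidPDE.Torus.geometry (Fin 3)) (Literature.MathematicalPhysics.KineticTheory.hsDiameter σ N) (N + 1), (∀ N, Measurable (fun p : ℝ × Literature.Analysis.FluidPDE.Config (N + 1) (Fin 3) Literature.MathematicalPhysics.KineticTheory.T3 => (Φ N).flow p.1 p.2)) → Literature.MathematicalPhysics.KineticTheory.TendstoHydroFieldsAt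 (fun N => Literature.MathematicalPhysics.KineticTheory.localGibbsLaw σ a₀ u₀ θ₀ N (Φ N)) Φ ρ u θ 0 → ∀ t ∈ Set.Ico 0 T, ∀ a : ℝ → Literature.MathematicalPhysics.KineticTheory.T3 → ℝ, Continuous (fun p : ℝ × Literature.MathematicalPhysics.KineticTheory.T3 => a p.1 p.2) → (∀ s x, 0 < a s x) → let G : Literature.Analysis.FluidPDE.Geometry (Fin 3) Literature.MathematicalPhysics.KineticTheory.T3 := Literature.Analysis.FluidPDE.Torus.geometry (Fin 3); let ε : ℕ → ℝ := fun N => Literature.MathematicalPhysics.KineticTheory.hsDiameter σ N; let P : (N : ℕ) → MeasureTheory.Measure (Literature.Analysis.FluidPDE.Config (N + 1) (Fin 3) Literature.MathematicalPhysics.KineticTheory.T3) := fun N => Literature.MathematicalPhysics.KineticTheory.localGibbsLaw σ a₀ u₀ θ₀ N (Φ N); let W : (N : ℕ) → ℝ → Literature.Analysis.FluidPDE.Config (N + 1) (Fin 3) Literature.MathematicalPhysics.KineticTheory.T3 → ℝ := fun N s => (Literature.Analysis.FluidPDE.hardSphereDomain G (N + 1) (ε N)).indicator (Literature.Analysis.FluidPDE.hsTransport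 (Φ N) s (Literature.Analysis.FluidPDE.canonicalDensity G (ε N) (N + 1) (Literature.MathematicalPhysics.KineticTheory.localGibbsProfile a₀ u₀ θ₀))); let F1 : ℕ → ℝ → Literature.MathematicalPhysics.KineticTheory.T3 × Literature.MathematicalPhysics.KineticTheory.V3 → ℝ := fun N s y => Literature.Analysis.FluidPDE.nthMarginal (N + 1) 1 (W N s) (fun _ => y); let ρF : ℕ → ℝ → Literature.MathematicalPhysics.KineticTheory.T3 → ℝ := fun N s x => ∫ v, F1 N s (x, v); let μF : ℕ → ℝ → MeasureTheory.Measure (Literature.MathematicalPhysics.KineticTheory.T3 × Literature.MathematicalPhysics.KineticTheory.V3) := fun N s => (MeasureTheory.volume : MeasureTheory.Measure (Literature.MathematicalPhysics.KineticTheory.T3 × Literature.MathematicalPhysics.KineticTheory.V3)).withDensity (fun y => ENNReal.ofReal (F1 N s y)); let μM : ℕ → ℝ → MeasureTheory.Measure (Literature.MathematicalPhysics.KineticTheory.T3 × Literature.MathematicalPhysics.KineticTheory.V3) := fun N s => (MeasureTheory.volume : MeasureTheory.Measure (Literature.MathematicalPhysics.KineticTheory.T3 × Literature.MathematicalPhysics.KineticTheory.V3)).withDensity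 (fun y => ENNReal.ofReal (ρF N s y.1 * Literature.Analysis.FluidPDE.localMaxwellian 1 (θ s y.1) (u s y.1) y.2)); let E : ℕ → ENNReal := fun N => ∫⁻ s in Set.Ioo 0 t, InformationTheory.klDiv (μF N s) (μM N s); ∀ N : ℕ, E N ≤ (∫⁻ s in Set.Ioo 0 t, InformationTheory.klDiv ((Φ N).lawAt (P N) s) (Literature.MathematicalPhysics.KineticTheory.localGibbsLaw σ (a s) (u s) (θ s) N (Φ N))) / ((N : ENNReal) + 1)) →
    VelocityDeviationEntropyBound := by
  intro hM hH hC a₀ θ₀ u₀ ha₀ hθ₀ hu₀ hap hθp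
  obtain ⟨σ₁, hσ₁, HM⟩ := hM a₀ θ₀ u₀ ha₀ hθ₀ hu₀ hap hθp
  obtain ⟨σ₃, hσ₃, HC⟩ := hC a₀ θ₀ u₀ ha₀ hθ₀ hu₀ hap hθp
  refine ⟨min σ₁ σ₃, lt_min hσ₁ hσ₃, ?_⟩
  intro σ hσ hσlt T ρ θ u hsol Φ hmeas h0 t ht a ha hapos
  have H₁ := HM σ hσ (lt_of_lt_of_le hσlt (min_le_left _ _)) T ρ θ u hsol Φ hmeas h0 t ht
  have H₂ := hH a₀ θ₀ u₀ ha₀ hθ₀ hu₀ hap hθp σ hσ T ρ θ u hsol Φ hmeas t ht H₁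
  have H₃ := HC σ hσ (lt_of_lt_of_le hσlt (min_le_right _ _)) T ρ θ u hsol Φ hmeas h0 t ht a ha hapos
  exact linBound_of_le_div H₂ H₃

/-- **THE SKELETON THEOREM**: the piece `VelocityDeviationEntropyBound` BY NAME from the three registered stubs. [folklore] -/
theorem VelocityDeviationEntropyBound_of : VelocityDeviationEntropyBound :=
  VelocityDeviationEntropyBound_of_stubs stub_sixthMomentBound stub_hellingerOfMoments stub_velocityChainRule

end Summit.AtomisticToContinuum.HydrodynamicLimit.Cruxes.ContactBilinearEntropyBound.VelocityDeviationBirth
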